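import Mathlib
import HarnessLib

/-!
# Route `SqueezeCycle`, support `BiaxialityDefect` (item stmt-NavierStokesRegularity-11615) — the
# middle strain eigenvalue is controlled by the nilpotency defect: `μ₁² ‖A‖²_F ≤ (144/25) ‖A²‖²_F`

For a trace-free real `3 × 3` matrix `A` let `μ₀ ≥ μ₁ ≥ μ₂` be the eigenvalues of `A + Aᵀ = 2S`
(Mathlib's antitone enumeration `Matrix.IsHermitian.eigenvalues₀`). Then
`μ₁² · ‖A‖²_F ≤ (144/25) · ‖A²‖²_F`, i.e. `|λ₂(S)| ≤ (6/5) ‖A²‖_F / ‖A‖_F` (sharp constant found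
numerically by planner and refuters `≈ 1.0234 < 6/5`): near-nilpotent (flattened-layer) velocity
gradients are never biaxially strained.

Proof. With `σ = ‖S‖²_F`, `w = |ω|²`, `q = |Sω|²` (`ω` the vorticity vector of `A`) the two
identities `‖A‖²_F = σ + w/2`, `‖A²‖²_F = ½(σ − w/2)² + q` hold for trace-free `A` (by `ring`, as in
`Theorems/SqueezeCycleShearEndpoint.lean`). Spectral input (`sq_eigenvalue_mul_norm_sq_le`): for the
symmetric `M = A + Aᵀ` and every vector `v`, `(min_k μ_k²) |v|² ≤ |M v|²` (expand `v` in an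
orthonormal eigenbasis), and for trace-free `M` the minimum of `μ_k²` is attained at the MIDDLE
eigenvalue (`μ₀ ≥ 0 ≥ μ₂` and `|μ₁| ≤ μ₀, |μ₂|`). Applied to `v = ω` this gives `μ₁² w ≤ 4 q`, applied to
the three coordinate vectors `3 μ₁² ≤ ‖M‖²_F = 4 σ`; the scalar inequality
`L (σ + w/2) ≤ (144/25)(½(σ − w/2)² + q)` for `L w ≤ 4q`, `3L ≤ 4σ` (`biaxialityDefect_scalar`) ends
the proof. The statement is the Prop of
`Summit.NavierStokesRegularity.NavierStokesRegularity.Theses.SqueezeCycle.BiaxialityDefect`, restated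
verbatim so that this module does not import the route file.

References: P. Vieillefosse, Physica A 125 (1984), doi:10.1016/0378-4371(84)90008-6; D. Buaria,
A. Pumir, E. Bodenschatz, Nat. Commun. 11 (2020) 5852; E. Miller, Arch. Ration. Mech. Anal. 2020,
doi:10.1007/s00205-019-01419-z.
-/

namespace Summit.NavierStokesRegularity.NavierStokesRegularity.Theorems

open scoped Matrix RealInnerProductSpace

/-- **Rayleigh lower bound through an eigenbasis.** For a real symmetric matrix `M` and a constant
`c ≤ μ_k²` below the squares of all its eigenvalues, `c ‖v‖² ≤ ‖M v‖²` for every `v`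
(expand `v` in the orthonormal eigenbasis `Matrix.IsHermitian.eigenvectorBasis` and use Parseval). -/
theorem sq_eigenvalue_mul_norm_sq_le {n : Type*} [Fintype n] [DecidableEq n] {M : Matrix n n ℝ}
    (hM : M.IsHermitian) {c : ℝ} (hc : ∀ j, c ≤ hM.eigenvalues j ^ 2) (v : EuclideanSpace ℝ n) :
    c * ‖v‖ ^ 2 ≤ ‖Matrix.toEuclideanLin M v‖ ^ 2 := by
  set b := hM.eigenvectorBasis
  have hsym : (Matrix.toEuclideanLin M).IsSymmetric := Matrix.isSymmetric_toEuclideanLin_iff.mpr hM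
  have hb : ∀ j, Matrix.toEuclideanLin M (b j) = hM.eigenvalues j • b j := by
    intro j
    apply WithLp.ofLp_injective 2
    rw [Matrix.ofLp_toLpLin, Matrix.toLin'_apply, hM.mulVec_eigenvectorBasis j, WithLp.ofLp_smul]
  have hinner : ∀ j, ⟪b j, Matrix.toEuclideanLin M v⟫ = hM.eigenvalues j * ⟪b j, v⟫ := by
    intro j
    rw [← hsym (b j) v, hb j, real_inner_smul_left]
  calc c * ‖v‖ ^ 2 = ∑ j, c * ⟪b j, v⟫ ^ 2 := by rw [← b.sum_sq_inner_right, Finset.mul_sum]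
    _ ≤ ∑ j, hM.eigenvalues j ^ 2 * ⟪b j, v⟫ ^ 2 :=
        Finset.sum_le_sum fun j _ => mul_le_mul_of_nonneg_right (hc j) (sq_nonneg _)
    _ = ∑ j, ⟪b j, Matrix.toEuclideanLin M v⟫ ^ 2 := by simp_rw [hinner, mul_pow]
    _ = ‖Matrix.toEuclideanLin M v‖ ^ 2 := b.sum_sq_inner_right _

/-- Bookkeeping on `Fin n` with `n = 3`: for an antitone `f : Fin n → ℝ` with `f 0 + f 1 + f 2 = ∑ f = 0`
the middle value has the least square, `(f 1)² ≤ (f k)²` for every `k` (`f 0 ≥ 0 ≥ f 2`). -/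
theorem antitone_fin_card_three_sq_middle_le {n : ℕ} (hn : n = 3) [NeZero n] (f : Fin n → ℝ)
    (hf : Antitone f) (h0 : ∑ j, f j = 0) : ∀ k, f 1 ^ 2 ≤ f k ^ 2 := by
  subst hn
  rw [Fin.sum_univ_three] at h0
  have h10 : f 1 ≤ f 0 := hf (by rw [Fin.le_iff_val_le_val]; simp)
  have h21 : f 2 ≤ f 1 := hf (by rw [Fin.le_iff_val_le_val]; simp)
  intro k
  fin_cases k
  · have : 0 ≤ (f 0 - f 1) * (f 0 + f 1) := mul_nonneg (by linarith) (by linarith)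
    simp only [Fin.zero_eta]
    nlinarith [this]
  · simp
  · have : 0 ≤ (f 1 - f 2) * (-(f 1 + f 2)) := mul_nonneg (by linarith) (by linarith)
    simp only [Fin.reduceFinMk]
    nlinarith [this]

/-- The scalar endgame of the biaxiality-defect inequality: for reals `σ, w, q` and `L ≥ 0` with `L w ≤ 4 q`
(Rayleigh at `ω`) and `3 L ≤ 4 σ` (Rayleigh at the coordinate vectors),
`L (σ + w/2) ≤ (144/25)(½(σ − w/2)² + q)`. If `σ ≤ 47w/50` the left side minus `(36/25) L w` is
nonpositive; otherwise `L ≤ 4σ/3` and `(18/25)(σ − w/2)² − (σ/3)(σ − 47w/50)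
= (29/75)(σ − 61w/116)² + (2543/34800) w² ≥ 0`. -/
theorem biaxialityDefect_scalar {σ w q L : ℝ} (hL : 0 ≤ L)
    (hLw : L * w ≤ 4 * q) (hLσ : 3 * L ≤ 4 * σ) :
    L * (σ + w / 2) ≤ 144 / 25 * (1 / 2 * (σ - w / 2) ^ 2 + q) := by
  rcases le_or_gt σ (47 / 50 * w) with h | h
  · have h1 : 0 ≤ L * (47 / 50 * w - σ) := mul_nonneg hL (by linarith)
    nlinarith [h1, sq_nonneg (σ - w / 2)]
  · have h1 : 0 ≤ (4 * σ - 3 * L) * (σ - 47 / 50 * w) := mul_nonneg (by linarith) (by linarith)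
    have h2 : 0 ≤ 29 / 75 * (σ - 61 / 116 * w) ^ 2 + 2543 / 34800 * w ^ 2 := by positivity
    nlinarith [h1, h2]

/-- **Biaxiality-defect inequality** (route `SqueezeCycle`, item `BiaxialityDefect`,
stmt-NavierStokesRegularity-11615): for a trace-free real `3 × 3` matrix `A`, with `μ` the antitone
eigenvalues of `A + Aᵀ`, `(μ 1)² · (∑ᵢⱼ Aᵢⱼ²) ≤ (144/25) · (∑ᵢⱼ (A²)ᵢⱼ²)`. -/
theorem biaxialityDefect_proof :
    ∀ A : Matrix (Fin 3) (Fin 3) ℝ, A.trace = 0 →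
      ((Matrix.isHermitian_add_transpose_self A).eigenvalues₀ 1) ^ 2 * (∑ i, ∑ j, (A) i j ^ 2) ≤
        (144 / 25) * (∑ i, ∑ j, (A * A) i j ^ 2) := by
  intro A hA
  set hM := Matrix.isHermitian_add_transpose_self A
  -- the equivalence between the two index types of the eigenvalue enumerations
  set e : Fin (Fintype.card (Fin 3)) ≃ Fin 3 := Fintype.equivOfCardEq (Fintype.card_fin _)
  have key : ∀ j, hM.eigenvalues (e j) = hM.eigenvalues₀ j := fun j => by
    simp [Matrix.IsHermitian.eigenvalues, e]
  -- over `ℝ` the conjugate transpose is the transpose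
  have hHT : A + Aᴴ = A + Aᵀ := by rw [Matrix.conjTranspose_eq_transpose_of_trivial]
  -- zero trace: the eigenvalues sum to zero, so the middle one has the least square
  have htr : (A + Aᵀ).trace = ∑ j, hM.eigenvalues₀ j := by
    rw [← hHT, hM.trace_eq_sum_eigenvalues, ← e.sum_comp]
    simp only [RCLike.ofReal_real_eq_id, id_eq, key]
  have htr0 : ∑ j, hM.eigenvalues₀ j = 0 := by
    rw [← htr, Matrix.trace_add, Matrix.trace_transpose, hA, add_zero]
  have hmid := antitone_fin_card_three_sq_middle_le (Fintype.card_fin 3) hM.eigenvalues₀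
    hM.eigenvalues₀_antitone htr0
  set μ := hM.eigenvalues₀
  have hc : ∀ j, μ 1 ^ 2 ≤ hM.eigenvalues j ^ 2 := fun j => by
    rw [← e.apply_symm_apply j, key]; exact hmid _
  -- Rayleigh lower bound `μ₁² |v|² ≤ |(A + Aᵀ) v|²` in coordinates
  have hv : ∀ f : Fin 3 → ℝ, μ 1 ^ 2 * (∑ i, f i ^ 2) ≤ ∑ i, ((A + Aᵀ) *ᵥ f) i ^ 2 := by
    intro f
    have h := sq_eigenvalue_mul_norm_sq_le hM hc (WithLp.toLp 2 f)
    rw [EuclideanSpace.real_norm_sq_eq, EuclideanSpace.real_norm_sq_eq, Matrix.toLpLin_apply,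
      WithLp.ofLp_toLp, hHT] at h
    simpa only [PiLp.toLp_apply] using h
  have hω := hv ![A 2 1 - A 1 2, A 0 2 - A 2 0, A 1 0 - A 0 1]
  have hx := hv ![1, 0, 0]
  have hy := hv ![0, 1, 0]
  have hz := hv ![0, 0, 1]
  simp only [Matrix.mulVec, dotProduct, Fin.sum_univ_three, Matrix.cons_val_zero,
    Matrix.cons_val_one, Matrix.cons_val_two, Matrix.head_cons, Matrix.tail_cons,
    Matrix.add_apply, Matrix.transpose_apply, Matrix.mul_apply, mul_one, mul_zero, add_zero,
    zero_add, one_pow, zero_pow, ne_eq, OfNat.ofNat_ne_zero, not_false_eq_true] at hω hx hy hz ⊢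
  have h22 : A 2 2 = -(A 0 0 + A 1 1) := by
    rw [Matrix.trace_fin_three] at hA; linarith
  rw [h22] at hω hz ⊢
  have hL : 0 ≤ μ 1 ^ 2 := sq_nonneg _
  -- the invariants: σ = ‖S‖², w = |ω|², q = |Sω|² in the entries (with A 2 2 eliminated)
  have hLw : μ 1 ^ 2 * ((A 2 1 - A 1 2) ^ 2 + (A 0 2 - A 2 0) ^ 2 + (A 1 0 - A 0 1) ^ 2) ≤
      4 * ((A 0 0 * (A 2 1 - A 1 2) + (A 0 1 + A 1 0) / 2 * (A 0 2 - A 2 0) +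
              (A 0 2 + A 2 0) / 2 * (A 1 0 - A 0 1)) ^ 2 +
            ((A 0 1 + A 1 0) / 2 * (A 2 1 - A 1 2) + A 1 1 * (A 0 2 - A 2 0) +
              (A 1 2 + A 2 1) / 2 * (A 1 0 - A 0 1)) ^ 2 +
            ((A 0 2 + A 2 0) / 2 * (A 2 1 - A 1 2) + (A 1 2 + A 2 1) / 2 * (A 0 2 - A 2 0) -
              (A 0 0 + A 1 1) * (A 1 0 - A 0 1)) ^ 2) := by
    linarith [hω]
  have hLσ : 3 * μ 1 ^ 2 ≤ 4 * (A 0 0 ^ 2 + A 1 1 ^ 2 + (A 0 0 + A 1 1) ^ 2 +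
      2 * (((A 0 1 + A 1 0) / 2) ^ 2 + ((A 0 2 + A 2 0) / 2) ^ 2 + ((A 1 2 + A 2 1) / 2) ^ 2)) := by
    linarith [hx, hy, hz]
  have fin := biaxialityDefect_scalar (σ := A 0 0 ^ 2 + A 1 1 ^ 2 + (A 0 0 + A 1 1) ^ 2 +
      2 * (((A 0 1 + A 1 0) / 2) ^ 2 + ((A 0 2 + A 2 0) / 2) ^ 2 + ((A 1 2 + A 2 1) / 2) ^ 2))
    hL hLw hLσ
  linarith [fin]

end Summit.NavierStokesRegularity.NavierStokesRegularity.Theorems
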